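import Summits.CriticalPhenomena.CardyFormulaZ2.Theorems.StripClusterRates.Negative.KacFromAboveFalse
import Literature.Probability.Percolation.CrossingChains

/-!
# `StripClusterRates` (stmt-CriticalPhenomena-13878): sub-multiplicativity of the crossing
# probability over disjoint blocks and finite-length LOWER bounds on the one-cluster rate

Negative-side lemmas for the crux `StripClusterRates` (cdisprove unit, cycle 2; part 1 of 3 —
`RateWindow.lean` adds BK and the two-sided window, `SubmultiplicativeTwo.lean` the two-cluster
analogue), complementing the UPPER bounds of `KacFromAboveFalse` with LOWER bounds:

* §1 `pOne_add_le : p₁(m₁+m₂+1,n) ≤ p₁(m₁,n)·p₁(m₂,n)` — a crossing of the long rectangle crosses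
  both vertex-disjoint blocks `[0,m₁]`, `[m₁+1,m₁+m₂+1]` (tree `lrCrossing_anti_left`,
  `exists_openConnIn_column_ge`, `lrCrossingAt`), the blocks are determined by disjoint pair sets
  (`disjoint_sym2_blocks`) hence independent, and the right block is a translate
  (`bondPercolation_real_lrCrossingAt`).
* §2 `pOne_blocks_le : p₁(k(m+1)+m,n) ≤ p₁(m,n)^{k+1}` and the FINITE-LENGTH LOWER BOUND
  `rateOne_ge_finite`: every limit `γ` of `-log p₁(m',n)/m'` has `γ ≥ -log p₁(m,n)/(m+1)` for
  EVERY `m`; with self-duality `p₁(n+1,n) = 1/2`: `rateOne_ge : γ₁(n) ≥ log 2/(n+2)`.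

(With `pOne_ge : p₁ ≥ 2⁻ᵐ` this also yields the EXISTENCE of `γ₁(n)` by Fekete alone; that
positive corollary belongs to the support item `StripRatesExist` and is attached there as evidence.)
-/

noncomputable section

open MeasureTheory Filter Topology
open Literature.Probability.LatticeModels Literature.Probability.Percolation

namespace Summit.CriticalPhenomena.CardyFormulaZ2.Theorems.StripClusterRates.Negative

open Summit.CriticalPhenomena.CardyFormulaZ2.Theses.CardyBoundaryCoulombGas (StripClusterRates)

/-! ## §1 Sub-multiplicativity of `p₁` over disjoint blocks -/

/-- The right block `[m₁+1, m₁+m₂+1] × [0,n]` contains the part `{m₁+1 ≤ z₀}` of the long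
rectangle `[0, m₁+m₂+1] × [0,n]`. [folklore] -/
theorem inter_subset_image_rectangle (m₁ m₂ n : ℕ) :
    (↑(rectangle (m₁ + m₂ + 1) n) : Set (Site 2)) ∩ {z | ((m₁ : ℤ) + 1) ≤ z 0} ⊆
      (· + pt (m₁ + 1) 0) '' (rectangle m₂ n : Set (Site 2)) := by
  intro z hz
  simp only [Set.mem_inter_iff, Finset.mem_coe, mem_rectangle_iff, Set.mem_setOf_eq] at hz
  refine ⟨z - pt (m₁ + 1) 0, Finset.mem_coe.2 (mem_rectangle_iff.2 ?_), sub_add_cancel z _⟩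
  simp only [Pi.sub_apply, Matrix.cons_val_zero, Matrix.cons_val_one, Matrix.cons_val_fin_one]
  omega

/-- The left block `[0,m₁]×[0,n]` contains the part `{z₀ ≤ m₁}` of the long rectangle. [folklore] -/
theorem inter_subset_rectangle (m₁ m₂ n : ℕ) :
    (↑(rectangle (m₁ + m₂ + 1) n) : Set (Site 2)) ∩ {z | z 0 ≤ (m₁ : ℤ)} ⊆
      (rectangle m₁ n : Set (Site 2)) := by
  intro z hz
  simp only [Set.mem_inter_iff, Finset.mem_coe, mem_rectangle_iff, Set.mem_setOf_eq] at hz ⊢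
  omega

/-- A point of the long rectangle on the column `m₁ + 1` is a shifted left-side point of the right
block. [folklore] -/
theorem mem_image_leftSide_of_col {m₁ m₂ n : ℕ} {z : Site 2}
    (hz : z ∈ (↑(rectangle (m₁ + m₂ + 1) n) : Set (Site 2))) (hz0 : z 0 = (m₁ : ℤ) + 1) :
    z ∈ (· + pt (m₁ + 1) 0) '' (leftSide m₂ n : Set (Site 2)) := by
  simp only [Finset.mem_coe, mem_rectangle_iff] at hz
  refine ⟨z - pt (m₁ + 1) 0, ?_, sub_add_cancel z _⟩
  simp only [Finset.mem_coe, leftSide, Finset.mem_filter, mem_rectangle_iff, Pi.sub_apply,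
    Matrix.cons_val_zero, Matrix.cons_val_one, Matrix.cons_val_fin_one]
  omega

/-- A right-side point of the long rectangle is a shifted right-side point of the right block. [folklore] -/
theorem mem_image_rightSide_of_mem_rightSide {m₁ m₂ n : ℕ} {y : Site 2}
    (hy : y ∈ (↑(rightSide (m₁ + m₂ + 1) n) : Set (Site 2))) :
    y ∈ (· + pt (m₁ + 1) 0) '' (rightSide m₂ n : Set (Site 2)) := by
  simp only [Finset.mem_coe, rightSide, Finset.mem_filter, mem_rectangle_iff] at hy
  refine ⟨y - pt (m₁ + 1) 0, ?_, sub_add_cancel y _⟩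
  simp only [Finset.mem_coe, rightSide, Finset.mem_filter, mem_rectangle_iff, Pi.sub_apply,
    Matrix.cons_val_zero, Matrix.cons_val_one, Matrix.cons_val_fin_one]
  omega

/-- **A crossing of `[0, m₁+m₂+1]×[0,n]` crosses the right block `[m₁+1, m₁+m₂+1]×[0,n]`**
(lattice configurations). [folklore] -/
theorem lrCrossingAt_of_lrCrossing_add {m₁ m₂ n : ℕ} {ω : BondConfig (Site 2)}
    (hωE : ω ⊆ (zdGraph 2).edgeSet) (hω : ω ∈ lrCrossing (m₁ + m₂ + 1) n) :
    ω ∈ lrCrossingAt (pt (m₁ + 1) 0) m₂ n := by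
  obtain ⟨x, hx, y, hy, hxy⟩ := hω
  have hx0 : x 0 = 0 := (Finset.mem_filter.1 (Finset.mem_coe.1 hx)).2
  have hy0 : y 0 = (m₁ + m₂ + 1 : ℕ) := (Finset.mem_filter.1 (Finset.mem_coe.1 hy)).2
  have hyx : ω ∈ openConnIn (↑(rectangle (m₁ + m₂ + 1) n)) y x := by rwa [openConnIn_comm]
  obtain ⟨z, hz0, hz⟩ := exists_openConnIn_column_ge hωE ((m₁ : ℤ) + 1)
    (by rw [hy0]; push_cast; omega) (by rw [hx0]; positivity) hyx
  have hz' := openConnIn_mono (inter_subset_image_rectangle m₁ m₂ n) y z hz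
  refine ⟨z, ?_, y, mem_image_rightSide_of_mem_rightSide hy, by rwa [openConnIn_comm]⟩
  obtain ⟨-, hzR, -⟩ := hz
  exact mem_image_leftSide_of_col hzR.1 hz0

/-- `LR` of the right block is determined by the pairs of its vertices. [folklore] -/
theorem determinedBy_lrCrossingAt (u : Site 2) (m n : ℕ) :
    DeterminedBy (lrCrossingAt u m n) ↑((rectangle m n).image (· + u)).sym2 := by
  rw [lrCrossingAt, ← Finset.coe_image]
  exact PlanarDuality.determinedBy_openCrossing _ _ _

/-- Vertex-disjoint blocks have disjoint pair sets. [folklore] -/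
theorem disjoint_sym2_blocks (m₁ m₂ n : ℕ) :
    Disjoint (↑(rectangle m₁ n).sym2 : Set (Sym2 (Site 2)))
      ↑((rectangle m₂ n).image (· + pt (m₁ + 1) 0)).sym2 := by
  rw [Finset.disjoint_coe, Finset.disjoint_left]
  intro e he he'
  induction e using Sym2.ind with
  | _ a b =>
    have ha : a ∈ rectangle m₁ n := Finset.mem_sym2_iff.1 he a (Sym2.mem_mk_left a b)
    have ha' : a ∈ (rectangle m₂ n).image (· + pt (m₁ + 1) 0) :=
      Finset.mem_sym2_iff.1 he' a (Sym2.mem_mk_left a b)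
    obtain ⟨c, hc, rfl⟩ := Finset.mem_image.1 ha'
    simp only [mem_rectangle_iff, Pi.add_apply, Matrix.cons_val_zero] at ha hc
    push_cast at ha
    omega

/-- **Sub-multiplicativity of the crossing probability over disjoint blocks**:
`p₁(m₁+m₂+1, n) ≤ p₁(m₁, n) · p₁(m₂, n)`. [folklore] -/
theorem pOne_add_le (m₁ m₂ n : ℕ) : pOne (m₁ + m₂ + 1) n ≤ pOne m₁ n * pOne m₂ n := by
  have hind := bondPercolation_real_inter_of_disjoint (zdGraph 2) half (disjoint_sym2_blocks m₁ m₂ n)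
    (PlanarDuality.determinedBy_openCrossing (rectangle m₁ n) _ _) (determinedBy_lrCrossingAt _ m₂ n)
    (measurableSet_lrCrossing m₁ n) (measurableSet_lrCrossingAt _ m₂ n)
  rw [bondPercolation_real_lrCrossingAt] at hind
  calc pOne (m₁ + m₂ + 1) n
      ≤ (bondPercolation (zdGraph 2) half).real (lrCrossing m₁ n ∩ lrCrossingAt (pt (m₁ + 1) 0) m₂ n) := by
        refine ENNReal.toReal_mono (measure_ne_top _ _) (measure_mono_ae ?_)
        filter_upwards [ae_subset_edgeSet (zdGraph 2) half] with ω hω h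
        exact ⟨lrCrossing_anti_left (by omega) n hω h, lrCrossingAt_of_lrCrossing_add hω h⟩
    _ = pOne m₁ n * pOne m₂ n := hind

/-! ## §2 Finite-length lower bounds on the one-cluster rate -/

/-- Iterated sub-multiplicativity: `p₁(k(m+1)+m, n) ≤ p₁(m,n)^{k+1}`. [folklore] -/
theorem pOne_blocks_le (m n k : ℕ) : pOne (k * (m + 1) + m) n ≤ pOne m n ^ (k + 1) := by
  induction k with
  | zero => simp
  | succ k ih =>
    have h := pOne_add_le (k * (m + 1) + m) m n
    have heq : k * (m + 1) + m + m + 1 = (k + 1) * (m + 1) + m := by ring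
    rw [heq] at h
    calc pOne ((k + 1) * (m + 1) + m) n ≤ pOne (k * (m + 1) + m) n * pOne m n := h
      _ ≤ pOne m n ^ (k + 1) * pOne m n :=
          mul_le_mul_of_nonneg_right ih (le_trans (by positivity) (pOne_ge m n))
      _ = pOne m n ^ (k + 1 + 1) := by ring

/-- The block subsequence `k ↦ k(m+1)+m` tends to infinity. [folklore] -/
theorem tendsto_blocks (m : ℕ) : Tendsto (fun k : ℕ ↦ k * (m + 1) + m) atTop atTop := by
  refine tendsto_atTop_mono (fun k ↦ ?_) tendsto_id
  simp only [id]; nlinarith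

/-- The comparison sequence `(k+1)c/(k(m+1)+m) → c/(m+1)`. [folklore] -/
theorem tendsto_blocks_ratio (m : ℕ) (c : ℝ) :
    Tendsto (fun k : ℕ ↦ (k + 1 : ℝ) * c / ((k * (m + 1) + m : ℕ) : ℝ)) atTop (𝓝 (c / (m + 1))) := by
  have h1 : Tendsto (fun k : ℕ ↦ c / ((m + 1 : ℝ) - 1 / ((k : ℝ) + 1))) atTop
      (𝓝 (c / ((m + 1 : ℝ) - 0))) := by
    refine tendsto_const_nhds.div (tendsto_const_nhds.sub tendsto_one_div_add_atTop_nhds_zero_nat) ?_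
    have : (0 : ℝ) ≤ m := by positivity
    linarith
  rw [sub_zero] at h1
  refine h1.congr' ?_
  filter_upwards [eventually_ge_atTop 1] with k hk1
  show c / (((m : ℝ) + 1) - 1 / ((k : ℝ) + 1)) = ((k : ℝ) + 1) * c / ((k * (m + 1) + m : ℕ) : ℝ)
  have hk : (1 : ℝ) ≤ (k : ℝ) := by exact_mod_cast hk1
  have hden : ((k * (m + 1) + m : ℕ) : ℝ) = ((k : ℝ) + 1) * (m + 1) - 1 := by push_cast; ring
  rw [hden]
  have hm : (0 : ℝ) ≤ m := by positivity
  have h1k : 1 / ((k : ℝ) + 1) ≤ 1 / 2 := by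
    rw [div_le_div_iff₀ (by positivity) (by norm_num)]; linarith
  have hne : ((m : ℝ) + 1) - 1 / ((k : ℝ) + 1) ≠ 0 := by
    have : (0 : ℝ) < 1 / ((k : ℝ) + 1) := by positivity
    intro h0; linarith
  have hne' : ((k : ℝ) + 1) * (m + 1) - 1 ≠ 0 := by
    intro h0; nlinarith
  field_simp

/-- **Finite-length lower bound on the one-cluster rate**: every limit `γ` of `-log p₁(m',n)/m'`
satisfies `γ ≥ -log p₁(m,n)/(m+1)` for EVERY `m`. [folklore] -/
theorem rateOne_ge_finite {n : ℕ} {γ : ℝ} (h : Tendsto (rateSeqOne n) atTop (𝓝 γ)) (m : ℕ) :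
    -Real.log (pOne m n) / (m + 1) ≤ γ := by
  have hlim := tendsto_blocks_ratio m (-Real.log (pOne m n))
  refine le_of_tendsto_of_tendsto hlim (h.comp (tendsto_blocks m)) (Eventually.of_forall fun k ↦ ?_)
  have hp : 0 < pOne m n := lt_of_lt_of_le (by positivity) (pOne_ge m n)
  have hpk : 0 < pOne (k * (m + 1) + m) n := lt_of_lt_of_le (by positivity) (pOne_ge _ n)
  have hlog : (k + 1 : ℝ) * -Real.log (pOne m n) ≤ -Real.log (pOne (k * (m + 1) + m) n) := by
    have := Real.log_le_log hpk (pOne_blocks_le m n k)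
    rw [Real.log_pow] at this; push_cast at this; linarith
  show (k + 1 : ℝ) * -Real.log (pOne m n) / ((k * (m + 1) + m : ℕ) : ℝ) ≤
    -Real.log (pOne (k * (m + 1) + m) n) / ((k * (m + 1) + m : ℕ) : ℝ)
  exact div_le_div_of_nonneg_right hlog (by positivity)

/-- **Self-duality lower bound: `γ₁(n) ≥ log 2/(n+2)`** (`p₁(n+1,n) = 1/2`). [folklore] -/
theorem rateOne_ge {n : ℕ} {γ : ℝ} (h : Tendsto (rateSeqOne n) atTop (𝓝 γ)) :
    Real.log 2 / (n + 2) ≤ γ := by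
  have := rateOne_ge_finite h (n + 1)
  rw [show pOne (n + 1) n = 1 / 2 from crossingProb_half_succ_self_holds n, one_div, Real.log_inv,
    neg_neg] at this
  push_cast at this
  convert this using 2; ring

end Summit.CriticalPhenomena.CardyFormulaZ2.Theorems.StripClusterRates.Negative
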